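import Literature.MathematicalPhysics.QuantumLattice.FermionQuasiFree
import Literature.MathematicalPhysics.QuantumLattice.FinDimSpectrum
import HarnessLib

/-!
# The free-fermion trace formula `tr Γ(γ) = det(𝟙 + γ)` (partition function of `dΓ(h)`)

Topic `Literature/MathematicalPhysics/QuantumLattice` (companion to `FermionQuasiFree.lean`, which has
the second quantisation `dGamma h = Σ h_{ij} c†_i c_j` on the finite Jordan–Wigner Fock space
`Fock ι = Finset ι → ℂ`, Gaudin's pull-through identities and the quasi-free two-point function, but
NOT the trace of the Gibbs weight itself). NAMED FACT (D-0014, `def … : Prop`, not asserted):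

* `partitionFn_dGamma_eq_det` — Dereziński–Gérard, *Mathematics of Quantization and Quantum Fields*
  (CUP, 2013/2022), §17.2, paragraph "Density matrix" (the display preceding Definition 17.36): for a
  positive trace-class `γ` on the one-particle space, on the fermionic Fock space `Γₐ(𝒵)`,
  "`Tr Γ(γ) = det(𝟙 + γ) = det(𝟙 − χ)⁻¹`" (`χ = γ(1+γ)⁻¹` the one-particle density). With
  `γ = e^{-βh}` for a Hermitian one-body matrix `h` (so `γ ≥ 0`) and `Γ(e^{-βh}) = e^{-β dΓ(h)}`,
  this is the partition function of the quadratic Hamiltonian: `tr e^{-β dΓ(h)} = det(1 + e^{-βh})`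
  (= `∏ₖ (1 + e^{-βεₖ})` over the eigenvalues of `h`; Gaudin, Nucl. Phys. 15 (1960) 89 derives the
  thermal Wick theorem from the same pull-through). Typed with the tree's `Matrix.partitionFn β H =
  tr e^{-βH}` (`FinDimSpectrum.lean`) and `dGamma` (`FermionQuasiFree.lean`), in finite dimension
  (`Fintype ι`), where trace-class is automatic.

Used by: route `HubbardSuperconductivity/SpinStructureRigidity`, support `SsrFreeParityCollapse`
(`stmt-HubbardSuperconductivity-1491`: the `U = 0` twisted partition functions), and by every
free-fermion calibration of the Hubbard routes. NOT here: the parity-twisted trace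
`tr[(−1)^N e^{-β dΓ(h)}] = det(1 − e^{-βh})` (same proof with `Γ(−γ)`; not printed in the cited
paragraph, left to the prover), Wick's theorem, infinite-dimensional (trace-class) versions.

## Mathlib

USED: `NormedSpace.exp` (matrix exponential), `Matrix.det`, `Matrix.trace`, `Matrix.IsHermitian`.
Mathlib has no second quantisation / CAR algebra (searched `dGamma`, `CAR`, `Fock`): tree notions.

## References

* J. Dereziński, C. Gérard, *Mathematics of Quantization and Quantum Fields*, Cambridge Monographs
  on Mathematical Physics, CUP (2013; 2022 printing), §17.2 "Quasi-free CAR representations",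
  paragraph "Density matrix" before Def. 17.36. [DerezinskiGerard2022]
* M. Gaudin, *Une démonstration simplifiée du théorème de Wick en mécanique statistique*,
  Nucl. Phys. 15 (1960) 89–91. [Gaudin1960]
-/

noncomputable section

namespace Literature.MathematicalPhysics.QuantumLattice

open Matrix

/-- **Free-fermion partition function = determinant** (Dereziński–Gérard, §17.2, "Density matrix",
display before Def. 17.36: `Tr Γ(γ) = det(𝟙 + γ)` for `γ ≥ 0` trace class; here `γ = e^{-βh}`,
`Γ(e^{-βh}) = e^{-β dΓ(h)}`): for a Hermitian one-body matrix `h` on a finite orbital set and real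
`β`, `tr e^{-β dΓ(h)} = det(1 + e^{-βh})`.
[cite: DerezinskiGerard2022, §17.2 (Density matrix, display before Def. 17.36)] -/
def partitionFn_dGamma_eq_det : Prop :=
  ∀ (ι : Type) [LinearOrder ι] [Fintype ι] (β : ℝ) (h : Matrix ι ι ℂ), h.IsHermitian →
    Matrix.partitionFn β (dGamma h) = (1 + NormedSpace.exp (-(β : ℂ) • h)).det

end Literature.MathematicalPhysics.QuantumLattice

end
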